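import Summits.CriticalPhenomena.PercolationContinuityZ3.Theorems.PercNearOneGluingNoHeavyLowerTailThreePartitionOneOrTwistedCert
import Summits.CriticalPhenomena.PercolationContinuityZ3.Theorems.PercNearOneGluingNoHeavyLowerTailThreePartitionJuntaAndVars
import Summits.CriticalPhenomena.PercolationContinuityZ3.Theorems.PercNearOneGluingNoHeavyLowerTailThreePartitionOneOrComb
import HarnessLib.Audit

/-!
# `NoHeavyLowerTail` (crux stmt-CriticalPhenomena-4575), master-family hierarchy P3 (gen 38): COMB-C3 for a DISJUNCTION OF COINS AND-ED WITH COINS —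
# `N_τ(OR_Q ∧ AND_J; A, B) ≥ 0` for ALL finite disjoint `Q, J`, ALL increasing `A, B`, EVERY twist; Sahi `E₃ ≥ 0` under every product measure

Support file (seat `prim-masterthm-p3`; `--supports stmt-CriticalPhenomena-4575`; memo
`run/shared/lean/prim/prim-masterthm/FROM-prim-masterthm-p3-g38-PDC-STRUCTURE.md` §5bis).  (1) `diagCert_or_untwisted`: gen 37's untwisted diagonal
majorant `K*` (`wPat_le_kStar`, `kStar_le_phiPat`, file `…OneOrHeart`) repackaged as a `DiagCert` for the junta `nonemptyFam` at twists missing the block;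
(2) with the twisted K* (`diagCert_orKappa`, file `…OneOrTwistedCert`): `exists_diagCert_or` — the disjunction carries a pure diagonal certificate at EVERY
twist; (3) by the closure under conjunction with coins (`exists_diagCert_andVars`, file `…JuntaAndVars`): **`threePartNT_orFam_and_nonneg`** and the any-slot
form; (4) the class {`orFam Q ∩ {J ⊆ ·}`} ∪ {principal} ∪ {∅} is closed under sections (`secFam_orFam`, `secFam_supset`), so by the comb bridge
**`combPos_sahiE_three_or_and` / `sahiE_three_or_and_nonneg`**: Sahi's `E₃(μ_p; 1_U, 1_V, 1_W)` is comb-positive (≥ 0 under every product measure) for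
`U = {S : S ∩ Q ≠ ∅, J ⊆ S}` — a clause AND units, e.g. `(p ∨ q ∨ r ∨ s) ∧ t ∧ u` — and `V, W` ARBITRARY increasing.  First all-`k` kernel class mixing `∨` and `∧`.
HONEST LABEL: the general conjecture (three arbitrary increasing events) stays OPEN; nothing here bears on the closed crux. [this work]
-/

noncomputable section

open Finset
open scoped symmDiff Classical

namespace Summit.CriticalPhenomena.PercolationContinuityZ3.Theorems.ThreePartition

variable {ι : Type*} [Fintype ι]

/-! ## The untwisted K* as a `DiagCert` -/

section Untwisted

variable {τ Q : Set ι} (hτ : τ ∩ Q = ∅)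
include hτ

/-- The two-copy junta form of the disjunction at an untwisted block is gen 37's `wPat`. [this work] -/
theorem sum_cJ_eq_wPat (𝔄 𝔅 : Set (Set ι)) :
    ∑ P ∈ cfgsIn Q, cJ τ Q nonemptyFam P * indZ (qc₂ τ Q P ∈ 𝔄 ∧ qc₃ τ Q P ∈ 𝔅) = wPat Q 𝔄 𝔅 := by
  unfold wPat
  rw [sum_cfgsIn_eq_patSum]
  unfold patSum
  refine sum_congr rfl fun u _ => sum_congr rfl fun a ha => ?_
  rw [mem_subsetsOf] at ha
  dsimp only
  unfold cJ wcoef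
  rw [qc₁_eq hτ, qc₂_eq hτ, qc₃_eq hτ, pt₃_mk ha, indZ_and]
  simp only [mem_nonemptyFam]

/-- The one-copy junta form of the disjunction at an untwisted block is gen 37's `phiPat` at the intersection. [this work] -/
theorem sum_eJ_eq_phiPat (𝔄 𝔅 : Set (Set ι)) :
    ∑ P ∈ cfgsIn Q, eJ τ Q nonemptyFam P * indZ (qc₃ τ Q P ∈ 𝔄 ∧ qc₃ τ Q P ∈ 𝔅) = phiPat Q (𝔄 ∩ 𝔅) := by
  unfold phiPat
  rw [sum_cfgsIn_eq_patSum]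
  have e : patSum Q (fun u a => eJ τ Q nonemptyFam (u, (Q \ u) \ a) * indZ (qc₃ τ Q (u, (Q \ u) \ a) ∈ 𝔄 ∧ qc₃ τ Q (u, (Q \ u) \ a) ∈ 𝔅))
      = patSum Q (fun u a => (2 * indZ a.Nonempty - indZ u.Nonempty) * indZ (a ∈ 𝔄 ∩ 𝔅)) := by
    unfold patSum
    refine sum_congr rfl fun u _ => sum_congr rfl fun a ha => ?_
    rw [mem_subsetsOf] at ha
    dsimp only
    unfold eJ
    rw [qc₁_eq hτ, qc₃_eq hτ, pt₃_mk ha]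
    simp only [mem_nonemptyFam]
    rfl
  rw [e, patSum_comm]
  unfold patSum wdiag
  refine sum_congr rfl fun a _ => ?_
  rw [mul_sum]
  exact sum_congr rfl fun u _ => by ring

/-- **The untwisted K* as a certificate** (`τ ∩ Q = ∅`): `κ(m) = [m ≠ ∅]·μ(m)`. [this work] -/
theorem diagCert_or_untwisted : DiagCert τ Q nonemptyFam (fun m => indZ m.Nonempty * mu Q m) := by
  refine ⟨fun m _ => ?_, fun 𝔄 𝔅 h𝔄 h𝔅 => ?_, fun 𝔄 𝔅 h𝔄 h𝔅 => ?_⟩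
  · by_cases hm : m.Nonempty
    · rw [indZ_of_pos hm, one_mul]; exact mu_nonneg Q hm
    · rw [indZ_of_neg hm, zero_mul]
  · rw [sum_cJ_eq_wPat hτ]
    have e : ∑ m ∈ subsetsOf Q, indZ m.Nonempty * mu Q m * indZ (m ∈ 𝔄 ∧ m ∈ 𝔅) = kStar Q 𝔄 𝔅 := by
      unfold kStar
      refine sum_congr rfl fun m _ => ?_
      rw [mul_comm (indZ m.Nonempty) (mu Q m), mul_assoc, ← indZ_and, mul_comm]
    rw [e]; exact wPat_le_kStar Q h𝔄 h𝔅
  · rw [sum_eJ_eq_phiPat hτ]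
    have e : ∑ m ∈ subsetsOf Q, indZ m.Nonempty * mu Q m * indZ (m ∈ 𝔄 ∧ m ∈ 𝔅) = kStar Q (𝔄 ∩ 𝔅) (𝔄 ∩ 𝔅) := by
      unfold kStar
      refine sum_congr rfl fun m _ => ?_
      rw [mul_comm (indZ m.Nonempty) (mu Q m), mul_assoc, ← indZ_and, mul_comm]
      congr 1
      exact indZ_congr ⟨fun h => ⟨h.1, h.2, h.2⟩, fun h => ⟨h.1, h.2.1⟩⟩
    rw [e]; exact kStar_le_phiPat Q (h𝔄.inter h𝔅)

end Untwisted

/-! ## Certificates at every twist; conjunction with coins -/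

/-- **The disjunction carries a pure diagonal certificate at every twist.** [this work] -/
theorem exists_diagCert_or (Q τ : Set ι) : ∃ κ : Set ι → ℤ, DiagCert τ Q nonemptyFam κ := by
  by_cases h : (τ ∩ Q).Nonempty
  · obtain ⟨x₀, hx₀⟩ := h
    exact ⟨_, diagCert_orKappa hx₀⟩
  · exact ⟨_, diagCert_or_untwisted (Set.not_nonempty_iff_eq_empty.1 h)⟩

/-- **COMB-C3 for (OR of coins) ∧ (coins)**: for every `Q`, every finite set `J` of coins disjoint from `Q`, every twist and all up-sets `A, B`:
`0 ≤ N_τ(orFam Q ∩ {S : J ⊆ S}; A, B)`. [this work] -/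
theorem threePartNT_orFam_and_nonneg (Q : Set ι) {J : Finset ι} (hJ : Disjoint (↑J : Set ι) Q) (τ : Set ι) {A B : Set (Set ι)}
    (hA : IsUpperSet A) (hB : IsUpperSet B) : 0 ≤ threePartNT τ (orFam Q ∩ {S | (↑J : Set ι) ⊆ S}) A B := by
  rw [← liftQ_nonemptyFam Q]
  exact threePartNT_liftQ_andVars_nonneg isUpperSet_nonemptyFam (fun τ₀ => exists_diagCert_or Q τ₀) hJ τ hA hB

/-- Any slot. [this work] -/
theorem threePartNT_nonneg_of_orFam_and (Q : Set ι) {J : Finset ι} (hJ : Disjoint (↑J : Set ι) Q) (τ : Set ι) {𝒰 𝒱 𝒲 : Set (Set ι)}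
    (h𝒰 : IsUpperSet 𝒰) (h𝒱 : IsUpperSet 𝒱) (h𝒲 : IsUpperSet 𝒲)
    (h : 𝒰 = orFam Q ∩ {S | (↑J : Set ι) ⊆ S} ∨ 𝒱 = orFam Q ∩ {S | (↑J : Set ι) ⊆ S} ∨ 𝒲 = orFam Q ∩ {S | (↑J : Set ι) ⊆ S}) :
    0 ≤ threePartNT τ 𝒰 𝒱 𝒲 := by
  rcases h with h | h | h
  · rw [h]; exact threePartNT_orFam_and_nonneg Q hJ τ h𝒱 h𝒲
  · rw [threePartNT_swap12, h]; exact threePartNT_orFam_and_nonneg Q hJ τ h𝒰 h𝒲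
  · rw [threePartNT_swap23, threePartNT_swap12, h]; exact threePartNT_orFam_and_nonneg Q hJ τ h𝒰 h𝒱

/-! ## COMB-C3 ⟹ Sahi `E₃ ≥ 0` for (clause ∧ units, arbitrary, arbitrary) -/

section Comb

open Literature.Combinatorics.Sahi2008
open SahiComb

variable {α : Type} [Fintype α]

/-- **COMB-C3 for ((OR of coins) ∧ (coins), arbitrary, arbitrary)**: `E₃(μ_p; 1_U, 1_V, 1_W)` is a nonnegative combination of the degree-3
tensor-Bernstein basis for `U = {S : S ∩ Q ≠ ∅} ∩ {S : J ⊆ S}` (`J` disjoint from `Q`) and all increasing `V, W`. [this work] -/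
theorem combPos_sahiE_three_or_and (Q : Set α) {J : Finset α} (hJ : Disjoint (↑J : Set α) Q) {V W : Set (Set α)}
    (hV : IsUpperSet V) (hW : IsUpperSet W) :
    CombPos (fun _ : α => 3) (fun p => sahiE (bernoulliWeight p) 3
      ![Literature.Probability.Percolation.DecisionTree.ind (orFam Q ∩ {S | (↑J : Set α) ⊆ S}),
        Literature.Probability.Percolation.DecisionTree.ind V, Literature.Probability.Percolation.DecisionTree.ind W]) := by
  refine combPos_sahiE_three_of_combCoef3_nonneg fun j => ?_
  by_cases hj : ∀ e, j e ≤ 3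
  · rw [combCoef3_eq_threePartNT _ V W hj, secFam_inter]
    rcases secFam_supset j hj J with h0 | h1
    · rw [h0, Set.inter_empty, threePartNT_empty_left]; exact_mod_cast le_rfl
    · rw [h1]
      rcases secFam_orFam j Q with hu | ho
      · -- ⊤ ∩ principal: determined by nothing, AND-ed with coins
        rw [hu]
        have hdet : DeterminedBy (↑(∅ : Finset (Act j)) : Set (Act j)) (Set.univ : Set (Set (Act j))) := fun _ => by simp
        exact_mod_cast threePartNT_determinedBy_and_nonneg' (S := ∅) (J := actIn j J) (by simp) (Finset.disjoint_empty_left _)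
          isUpperSet_univ hdet (twist j) (isUpperSet_secFam j hV) (isUpperSet_secFam j hW)
      · rw [ho]
        have hJ' : Disjoint (↑(actIn j J) : Set (Act j)) {e : Act j | e.1 ∈ Q} := by
          rw [Set.disjoint_left]; intro e he heQ
          unfold actIn at he
          exact Set.disjoint_left.1 hJ (Finset.mem_coe.2 (Finset.mem_filter.1 (Finset.mem_coe.1 he)).2) heQ
        exact_mod_cast threePartNT_orFam_and_nonneg {e : Act j | e.1 ∈ Q} hJ' (twist j) (isUpperSet_secFam j hV) (isUpperSet_secFam j hW)
  · rw [combCoef3_eq_zero_of_not_le _ V W hj]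

/-- **Sahi's `E₃ ≥ 0` for ((OR of coins) ∧ (coins), arbitrary, arbitrary) under every product measure.** [this work] -/
theorem sahiE_three_or_and_nonneg (Q : Set α) {J : Finset α} (hJ : Disjoint (↑J : Set α) Q) {V W : Set (Set α)}
    (hV : IsUpperSet V) (hW : IsUpperSet W) (p : α → unitInterval) :
    0 ≤ sahiE (bernoulliWeight p) 3 ![Literature.Probability.Percolation.DecisionTree.ind (orFam Q ∩ {S | (↑J : Set α) ⊆ S}),
      Literature.Probability.Percolation.DecisionTree.ind V, Literature.Probability.Percolation.DecisionTree.ind W] :=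
  (combPos_sahiE_three_or_and Q hJ hV hW).nonneg p

end Comb

end Summit.CriticalPhenomena.PercolationContinuityZ3.Theorems.ThreePartition

end
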